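import Mathlib
import HarnessLib
import HarnessLib.Audit
import Summits.KontsevichZagierPeriods.Statement
import HarnessLib.Audit.Status.Attr

/-!
Route: CommonUnfolding

DORMANT since 2026-08-24T14:43:36Z (reconciler: no traction for 6.8 d (last activity item-evidence-added at 2026-08-17T18:09:59Z); parked, not closed — `ledger route dormant route-KontsevichZagierPeriods-CommonUnfolding --off` to reacti) — unstaffed, not closed; items shared with open routes are served there. `ledger route dormant <id> --off` reactivates.

# Route CommonUnfolding — every valley is a peak — KZ-equivalence is a common unfolding (one
integrand, two orders of integration)

It suffices to show X = COMMON UNFOLDING (card every-valley-is-a-peak-common-unfolding, thesis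
(T3)): for any two KZ-rational
integral representations r (dim n), r′ (dim m) with the same value there are N ≥ max(n,m), ONE
representation R of dimension N (the
PEAK) and two DESCENTS from [R] — one ending level-equivalent to [r], the other to [r′]. A descent
is a finite chain of ROUNDS on
effective formal sums; a round first massages the current sum by LEVEL moves (the subgroup Lv
generated by domain additivity (1a),
integrand additivity (1b) and coordinate permutations — junk (null / zero-integrand / antisymmetric
sums) is invisible modulo Lv) into
a sum of bands ΣBᵢ, then replaces every band by its base through one Newton–Leibniz instance each
(`of Bᵢ − of bᵢ ∈ newtonLeibnizRel`,
read FORWARDS: integrate out the last variable, the fibrewise primitive being ℚ-semialgebraic). In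
words: two equal integrals are two
iterated Fubini shadows, in two coordinate orders and with scissors allowed at every level, of ONE
semialgebraic integrand on ONE
semialgebraic set; the height N − max(n,m) is unbounded. No change of variables other than
coordinate permutations occurs anywhere.
KontsevichZagierPeriods ∧ PeakNormalForm ⇒ X ⇒ KontsevichZagierPeriods (precisely: X ⟺ summit ∧
PeakNormalForm restricted to rational
pairs; Sketch.lean rc 0) — X is summit-strength, and the ranked cruxes 2–4 are transcendence-free
statements about the PRESENTATION
(the faithfulness direction summit ⇒ X: the reformulation is not stronger than Conjecture 1), not
steps towards X. DECIDING PATH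
(route-choice repair 2026-08-16, hold target-unreachable): `closes (hP : PeakNormalForm) (hC :
UnfoldingComplement) : KontsevichZagierPeriods`
with UnfoldingComplement := PeakNormalForm → X the conjecture-grade COMPLEMENT (support, rank 9, ≡
Conjecture 1 given the normal form,
not staffed by this route's mechanism; on the tame-cube sector it is Ayoub2015 Conj. 1.1, whose
explicit Stokes form
f̃ − f̃′ = Σᵢ(∂ᵢgᵢ − gᵢ|₁ + gᵢ|₀) is literally a one-round common unfolding whose peak is the padded
integrand itself); X → summit
(soundness of descents) is proved inside `closes` and recorded as the Assembly item.
Lean: `let Lv : AddSubgroup Literature.NumberTheory.Transcendental.KZ.FormalRep :=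
AddSubgroup.closure (Literature.NumberTheory.Transcendental.KZ.domainAddRel ∪
Literature.NumberTheory.Transcendental.KZ.integrandAddRel ∪ {c :
Literature.NumberTheory.Transcendental.KZ.FormalRep | ∃ (d : ℕ) (s s' :
Literature.NumberTheory.Transcendental.KZ.IntegralRep d) (p : Equiv.Perm (Fin d)), s'.domain = (fun
x : Fin d → ℝ => x ∘ ⇑p) '' s.domain ∧ (∀ x ∈ s.domain, s.integrand x = s'.integrand (x ∘ ⇑p)) ∧ c =
Literature.NumberTheory.Transcendental.KZ.of s - Literature.NumberTheory.Transcendental.KZ.of s'});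
let Rnd : Literature.NumberTheory.Transcendental.KZ.FormalRep →
Literature.NumberTheory.Transcendental.KZ.FormalRep → Prop := fun C c => ∃ (d k : ℕ) (B : Fin k →
Literature.NumberTheory.Transcendental.KZ.IntegralRep (d + 1)) (b : Fin k →
Literature.NumberTheory.Transcendental.KZ.IntegralRep d), (∀ i,
Literature.NumberTheory.Transcendental.KZ.of (B i) - Literature.NumberTheory.Transcendental.KZ.of (b
i) ∈ Literature.NumberTheory.Transcendental.KZ.newtonLeibnizRel) ∧ C - ∑ i,
Literature.NumberTheory.Transcendental.KZ.of (B i) ∈ Lv ∧ c = ∑ i,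
Literature.NumberTheory.Transcendental.KZ.of (b i); ∀ ⦃n m : ℕ⦄ (r :
Literature.NumberTheory.Transcendental.KZ.IntegralRep n) (r' :
Literature.NumberTheory.Transcendental.KZ.IntegralRep m), r.IsRational → r'.IsRational → r.value =
r'.value → ∃ (N : ℕ) (R : Literature.NumberTheory.Transcendental.KZ.IntegralRep N) (c c' :
Literature.NumberTheory.Transcendental.KZ.FormalRep), Relation.ReflTransGen Rnd
(Literature.NumberTheory.Transcendental.KZ.of R) c ∧ Relation.ReflTransGen Rnd
(Literature.NumberTheory.Transcendental.KZ.of R) c' ∧ c -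
Literature.NumberTheory.Transcendental.KZ.of r ∈ Lv ∧ c' -
Literature.NumberTheory.Transcendental.KZ.of r' ∈ Lv`

## Assembly
Pure soundness, provable now (≈ 300 lines): given KZ-rational r, r′ with equal values, X yields R,
c, c′ with round-chains [R] ⇒ c,
[R] ⇒ c′ and c − [r], c′ − [r′] ∈ Lv. Every round satisfies C − c₁ = (C − ΣBᵢ) + Σ(of Bᵢ − of bᵢ) ∈
relations because Lv ≤ relations
(domainAddRel, integrandAddRel ⊆ relations by `*_subset_relations`; a coordinate permutation x ↦ x ∘
p is a changeOfVariablesRel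
instance: polynomial hence ℚ-semialgebraic map, injective, HasFDerivWithinAt of a continuous linear
map, |det| = |sign p| = 1) and
newtonLeibnizRel ⊆ relations; induction along Relation.ReflTransGen gives [R] − c, [R] − c′ ∈
relations, hence
[r] − [r′] = ([r] − c) + (c − [R]) + ([R] − c′) + (c′ − [r′]) ∈ relations, i.e. KZ.Equivalent r r′,
which is the summit
(`KontsevichZagierPeriods_iff`). `example : Assembly = (CommonUnfoldingThesis →
KontsevichZagierPeriods) := rfl` in Sketch.lean (rc 0).

Rationale: WHY THIS LINE. Read rule 3) forwards: a Newton–Leibniz instance IS "integrate out the last variable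
by Fubini, the partial primitive being
semialgebraic" (KZCalculus.lean, `eval_eq_zero_of_mem_newtonLeibnizRel_holds`), so a KZ derivation
is a zig-zag of DOWN steps D,
UP steps U = D⁻¹ and level steps; the card's INTERCHANGE LEMMA (crux 4: two bands over one base ⇒
one double band over both, with the
signed-coupling integrand R = f₁⊗h₃ + h₁⊗f₃ − g·h₁⊗h₃, hᵢ = 1/(bᵢ−aᵢ), whose two partial primitives
are built from the GIVEN
primitives — nothing is ever integrated) turns every valley D·U into a peak U·D of the same length,
and Newman's diamond lemma
(Newman1942) plus free cancellation (signs live in the integrand: [σ,f]+[σ,−f] ∈ Lv) sorts every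
derivation into the single-peak form
r ↗ R ↘ r′ (crux 2, PeakNormalForm), once rule 2) is itself unfolded (crux 3, TransportElimination =
Ayoub2015 Rem. 1.5 /
Fresan2024 Rem. 3.7 "substitution costs one variable", made semialgebraic via Rudin1976 Thm 10.7
primitive-map factorisation; the
strategy CressonViusos2022 §2.1 dismiss — Fubini + Newton–Leibniz — is thereby COMPLETE as a normal
form, the transcendence of
primitives having moved into the existence of R). Imported: rewriting theory (local confluence ⇒
Church–Rosser), signed couplings
with prescribed marginals (Fréchet classes; the formula is standard in marginal problems, new in
this role), real semialgebraic
geometry (Tarski–Seidenberg, in tree: `tarski_seidenberg_real_holds`; C¹ cell decomposition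
BochnakCosteRoy1998 §2.9 for crux 3);
archetype Anderson1991 (Selberg's integral = one integral in two orders). Versus the open routes:
ScissorsTransport eliminates rule
3) in favour of rule 2) (Monge form, stabilised by free dimensions); this line eliminates rule 2) in
favour of rule 3) and keeps
no transport at all — the two are the opposite normal forms of the same calculus;
Neg/LowDimension/NoriTransfer/Grothendieck/
AyoubSpecialisation/ExpConservative/MultivaluedCoV/LiouvilleUnfolding do not touch the presentation.
Value: Conjecture 1 becomes an
EXISTENCE problem for one function R with two prescribed shadow towers (search space for
collision-census: one unknown, linear
constraints, parameter = height), and the negative programme gets a graded target (crux 5: the first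
height lower bound; a
Fubini-invariant = functional of (σ,f) invariant under Lv and under semialgebraic-primitive fibre
integration is what Neg 0313 must
produce). Negatives index: empty at filing.

RANKED CRUXES. #0 CommonUnfoldingThesis (target) — X of § Thesis: KZ-rational r, r′ with equal
values have a common unfolding — a peak R : IntegralRep N and two round-chains
(Relation.ReflTransGen of `Rnd`) from [R] ending Lv-equivalent to [r] and to [r′]; Lv =
AddSubgroup.closure(domainAddRel ∪ integrandAddRel ∪ coordinate-permutation instances), Rnd C c ⟺ C
≡ ΣBᵢ mod Lv, c = Σbᵢ, each of Bᵢ − of bᵢ ∈ newtonLeibnizRel. Summit-strength (summit ∧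
PeakNormalForm ⇒ X ⇒ summit; reached in the deciding theorem as the composite of PeakNormalForm and
the complement #9). [difficulty: open-problem] (why it might fail: At least summit-strength: every
strength barrier applies; and if TransportElimination fails for some semialgebraic substitution the
permutation-only level class makes X strictly STRONGER than Conjecture 1 (pivot: admit
changeOfVariablesRel into Lv).) [KontsevichZagier2001, Ayoub2015, CressonViusos2022, Anderson1991]
#2 PeakNormalForm (crux) — SINGLE-PEAK NORMAL FORM (card (T1)+(T2)), transcendence-free: if r (dim
n) and r′ (dim m) are KZ-equivalent in the fixed calculus then they have a common unfolding in the
sense of X (same Lv, same Rnd; N unbounded). Proof plan: CU is reflexive, symmetric, additive;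
generators unfold (1a, 1b, permutations: height 0; Newton–Leibniz: the band itself; rule 2):
TransportElimination); transitivity = DIAMOND: the elementary valley 'one round down from C and from
C′ to Lv-equivalent sums' completes to a common peak ONE round up (refine both band families over a
common base partition by 1a-splits of bands, lift 1b-splits by B ↦ [f − h·g″] + [h·g″] and
permutations by permuting base coordinates of the band, keep merges/deletions as density
bookkeeping, then apply the k×l interchange formula Rᵢⱼ = fᵢ h′ⱼ/l + hᵢ f′ⱼ/k − G hᵢ h′ⱼ/(kl) over
each base piece, degenerate fibres split off as junk); grid induction; finally [r] − [r′] ∈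
relations ⇒ [r]+E ≡ [r′]+E with CU, and E is cancelled by adding E⁻ (∈ Lv together). [deps:
TransportElimination, InterchangeLemma] [difficulty: XL] (why it might fail: Needs
TransportElimination; the diamond must survive Lv-equivalences that are permutation coboundaries (G
− G′ = Σ(h − h∘p), not plain a.e. equality) and NL's whole-open-fibre differentiability (kinked
primitives force extra splits); else only a weaker 'unfold–transport–fold' form holds.) [Newman1942,
Ayoub2015, CressonViusos2022, KontsevichZagier2001]
#3 TransportElimination (crux) — RULE 2) UNFOLDS (card (N3) + card ftc-twice-cube-stokes-form; Ayoub
Rem 1.5 in the semialgebraic calculus): the two sides r, r′ of any change-of-variables instance (Φ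
ℚ-semialgebraic, injective, differentiable within σ, f = f′∘Φ·|det Φ′|) have a common unfolding with
level class Lv = scissors + coordinate permutations only. Plan: null/lower-dimensional and {det Φ′ =
0} parts are junk; on open cells Φ is C¹ and factors into primitive maps (one coordinate each) and
flips (Rudin 10.7, finitely many semialgebraic cells); a one-coordinate substitution u = φ(x,t)
unfolds at height 1 by R = ∂ᵤf′(x,u)·∂ₜφ(x,t) on the region between u₀ and φ(x,t) (both partial
primitives f′·∂ₜφ and ∂ᵤf′·φ are semialgebraic; anchor u₀ at a regular point so that |R| is
integrable), with 1b bookkeeping of the anchor terms one dimension down; unbounded corners (φ → ∞)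
need the finite-mass variant R = ∂ᵥ∂ₜ[h(vt)·t·f(t)] (h polynomial, h′(1)=1, h′(λ)=0, h(1)=h(λ)) on
{λ < vt < 1}. Checked by hand at height 1 on the reflection pair [(1,2),1/(3−x)] ~ [(1,2),1/x] (peak
u⁻²·[u>3−t] + u⁻²([u<2]−[u>2]) on (1,2)×(1,3)) and on translations (product peak). [deps:
InterchangeLemma] [difficulty: L] (why it might fail: NL fibres must be bounded and every
bookkeeping term of finite mass: unbounded data and endpoint singularities need case-built peaks;
the primitive-map factorisation of a merely differentiable injective SA map must hold on FINITELY
many cells with ∂φ ≠ 0.) [Ayoub2015, Fresan2024, Rudin1976, BochnakCosteRoy1998, CressonViusos2022]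
#4 InterchangeLemma (crux) — EVERY VALLEY IS A PEAK (card (N1)), provable now: if b₁ and b₃ (dim
n+1) both descend to the same base r₂ (dim n) by one Newton–Leibniz instance each, and all fibres of
both bands over r₂.domain are nondegenerate, then there is a double band R (dim n+2) over b₁ — fibre
coordinate s ∈ [a₃ x, b₃ x], integrand R(x,t,s) = f₁(x,t)h₃(x) + h₁(x)f₃(x,s) − g(x)h₁(x)h₃(x), hᵢ =
1/(bᵢ−aᵢ), s-primitive f₁·(s−a₃)h₃ + h₁F₃ − g h₁(s−a₃)h₃ — with `of R − of b₁ ∈ newtonLeibnizRel`,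
and its coordinate swap R′(x,s,t) = R(x,t,s) satisfies `of R′ − of b₃ ∈ newtonLeibnizRel`
(t-primitive F₁h₃ + h₁(t−a₁)f₃ − g(t−a₁)h₁h₃); R′ is the image of R under the swap of the last two
coordinates (a permutation level move). ∫|R| ≤ ‖f₁‖₁ + ‖f₃‖₁ + ‖g‖₁. Est. 400–700 lines over
KZCalculus/SemialgebraicMapsProofs (Tarski–Seidenberg in tree). [difficulty: provable-now] (why it
might fail: Only through the exact side conditions of newtonLeibnizRel: extracting (a,b,F) from a
membership in the free abelian group, semialgebraicity of 1/(b−a) and of F₃∘(x,s) on the double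
band, Tonelli for integrability; degenerate fibres are excluded by hypothesis on purpose.)
[KontsevichZagier2001, Anderson1991, Newman1942]
#5 HeightTwoPair (crux) — FIRST HEIGHT LOWER BOUND (card (N4); Ayoub's Rem 1.2 heuristic 'the number
of variables must grow' made a theorem at the first level): there are KZ-rational r, r′ of dimension
2 that HAVE a common unfolding but none with peak dimension N ≤ 3 (height ≤ 1). Candidates: KZ's
ζ(2) pair ([(0,1)², 1/(1−xy)] against a rational π²/6-representation; KZ's own chain has height 2),
Gauss-multiplication pairs. A proof is a two-sided version of the catalogued primitive obstruction:
no semialgebraic R on a 3-dimensional set has the two prescribed iterated shadows with semialgebraic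
partial primitives. [deps: PeakNormalForm] [difficulty: open-problem] (why it might fail: Height
might always compress to 1 in dimension 2 (no lower-bound technique for unfolding height exists; the
only tool is the one-sided obstruction noSemialgebraicPrimitive_inv_sub_two), and the positive half
needs an explicit height-2 unfolding of a genuinely transcendental pair.) [Ayoub2015, Fresan2024,
KontsevichZagier2001,
Literature/Barriers/KontsevichZagierPeriods/AlgebraicPrimitivesObstruction.lean]
#9 UnfoldingComplement (support; conjecture-grade COMPLEMENT, route-choice repair 2026-08-16 for the
hold target-unreachable) — PeakNormalForm → CommonUnfoldingThesis: given the single-peak normal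
form, equal values have common unfoldings. ≡ Conjecture 1 given PeakNormalForm (Sketch.lean
`unfoldingComplement_iff`, rc 0); it is the second hypothesis of the re-cut deciding theorem `closes
(hP : PeakNormalForm) (hC : UnfoldingComplement)` and is NOT staffed by this route's mechanism
(house style of FurushoPentagon.SectorToKernel / Grothendieck.SectorComplement). Where its content
lives: on the tame-cube sector (domain [0,1]ⁿ, integrand algebraic and analytic near the closed
polydisc) it is Ayoub2015 Conj. 1.1 in explicit form — ∫(f̃ − f̃′) = 0 ⇒ f̃ − f̃′ = Σᵢ(∂ᵢgᵢ −
gᵢ|_{zᵢ=1} + gᵢ|_{zᵢ=0}) on [0,1]^m — which is a ONE-ROUND common unfolding whose peak is the padded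
integrand [[0,1]^m, f̃] itself (bands [∂ᵢgᵢ] with zᵢ permuted last descend by the GIVEN primitives
gᵢ, the padded boundary terms by −zᵢ·(gᵢ|₁ − gᵢ|₀), the leftover antisymmetric pair is level junk;
neither the interchange lemma nor transport elimination is needed there); globally it is that plus
the compilation of KZ-rational representations into tame cubes inside the rules
(VeryGoodTransfer.RationalRepsResolve stmt-5089, ScissorsTransport.VolumeForm, ViuSos2021 Thm 1.1).
[difficulty: open-problem] (why it might fail: exactly when Conjecture 1 fails, given
PeakNormalForm; every strength barrier applies.) [KontsevichZagier2001, Ayoub2015, Fresan2024,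
HuberMullerStach2017, ViuSos2021]

TWO-LAYER PLAN. Foreseen glued splits (none filed now; k ≤ 3, depth 1). PeakNormalForm ⇐
ElementaryDiamond (one round down on each side to
Lv-equivalent sums ⇒ one common round up; the k×l interchange + level lifts) → GeneratorsUnfold
(1a/1b/perm/NL trivial, rule 2) =
TransportElimination, plus the cancellation/grid bookkeeping) → PeakNormalForm. TransportElimination
⇐ OneCoordinateSubstitution
(height-1 unfolding of u = φ(x,t), bounded and corner cases) → PrimitiveMapFactorisation
(semialgebraic C¹ cells, Rudin 10.7) →
TransportElimination. CommonUnfoldingThesis ⇐ sector children once PeakNormalForm lands: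
StuffleUnfolding (double-shuffle pairs of
MZV simplex representations at height ≤ 2, shared with Grothendieck 0275), TriplicationUnfolding
(Neg 0312's Gauss-multiplication
pair read through the Fermat-curve correspondence, shared with Neg/MultivaluedCoV), DimOneHeightOne
(Baker sector, shared with
LowDimension 0405). InterchangeLemma needs no split. UnfoldingComplement ⇐ AyoubStokesUnfolding
(tame-cube sector, conjecture-grade: Ayoub2015 Conj. 1.1 transcribed with the
closed-POLYDISC convergence condition — the tree's real-analytic `IsTameCube` is weaker, e.g.
1/(4z²−4z+2)) → CubeCompilationCU (transfer, L/XL: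
every KZ-rational representation has a common unfolding with a tame-cube representation) →
UnfoldingComplement (glue through the
transitivity half of PeakNormalForm); to be filed by the tenure planner only once PeakNormalForm
moves.

KILL CRITERIA. A KZ-equivalent pair with provably NO common unfolding refutes PeakNormalForm: if the
pair is a change-of-variables instance it
refutes TransportElimination too and forces the PIVOT 'admit changeOfVariablesRel into Lv' (restate
X/PeakNormalForm in the
unfold–transport–fold form; the route survives with height still meaningful); if it is not, the
single-peak mechanism is dead —
close `refuted:PeakNormalForm` and hand the separating argument to Neg 0313 as the first
Fubini-invariant. A refutation of
InterchangeLemma can only be a side-condition defect (restate with the missing hypothesis, not a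
kill). ¬X by a pair not known to be
KZ-equivalent is a candidate refutation of the SUMMIT (pivot to Neg with the witness). HeightTwoPair
refuted (height always ≤ 1 in
dimension 2) does not kill the line — it sharpens X to a bounded search and is recorded as support.
PeakNormalForm proved elsewhere in
the weak form moots crux 3 only. UnfoldingComplement cannot be refuted without refuting Conjecture 1
(given PeakNormalForm): a claimed
refutation is a summit-refutation candidate and goes to route Neg with its witness; it closes only
when Conjecture 1 does (any kernel-form route).

NOT DECOMPOSED YET. The Literature-level DEFINITIONS (Lv, Rnd, CommonUnfolding, height) are inlined
as `let`s in every statement and requested as a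
notion (Definition requests) — restating the items over the landed definitions is a tenure edit, not
a split. The elementary
diamond, the cancellation lemma (c+E ~ c′+E ⇒ c ~ c′ via E⁻ and zero terms), the
permutation-coboundary case of level lifting, the
k×l interchange, the corner peaks for unbounded substitutions, the C¹-cell/primitive-map
factorisation, and all sector constructions
(MZV stuffle, triplication, KZ's ζ(2) chain as an explicit height-2 calibration) are layer-2
children or prover-level `--supports`
lemmas. The negative programme beyond HeightTwoPair (Fubini-invariants) stays with route Neg.

CHEAPEST FALSIFIER. (i) Re-derive InterchangeLemma's two Newton–Leibniz instances from the explicit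
R, primitives and swap against the exact side
conditions of `KZ.newtonLeibnizRel` — done by the card's auditor and again here: passes (degenerate
fibres excluded by hypothesis).
(ii) Run the STRONG form on the tree's hardest dimension-1 witness,
ScissorsTransport.DimOneTransportFails
r = [(0,1),1] ~ r′ = [(1,2), 1+1/x−1/(3−x)] (log obstruction; the reflection y = 3−x is not a level
move): done by hand this session —
height-1 peak P = [(1,2)×(0,1), 1] + slab[(1,2), 1/x] + [(1,2)×(1,3), −R], R = u⁻²·[u>3−t] +
u⁻²([u<2]−[u>2]); r′-side shadows
[(1,2),1] + [(1,2),1/x] + [(1,2),−1/(3−t)] ≡ r′, r-side shadows [(0,1),1] + [(1,2),1/x] +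
[(1,2),−1/u] ≡ r (the last two cancel in
Lv): PASSES (NOTES.md). (iii) Next cheapest, for a refuter with sympy: the unbounded inversion pair
[(0,1),1] ~ [(1,∞), u⁻²] at
height 1 with BOUNDED fibres — the corner recipe R = ∂ᵥ∂ₜ[h(vt)·t·f(t)] on {λ < vt < 1} predicts a
peak; if none exists,
compactifications need height ≥ 2 and TransportElimination's risk line is live.

NUMBERS. Items at open: 6 (target, 4 cruxes, assembly); 7 after the 2026-08-16 route-choice repair
(+ the complement UnfoldingComplement, support rank 9; deciding theorem `closes (hP :
PeakNormalForm) (hC : UnfoldingComplement)`, 114 lines, axioms propext/Classical.choice/Quot.sound).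
Height of the known chains in this language: substitution in one variable = 1
(Ayoub2015 Rem 1.5 / Fresan2024 Rem 3.7); KZ's ζ(2) = π²/6 chain = 2 (card); translation/reflection
pairs = 1 (this session);
transposition pairs = 0 (permutations are level moves; without them NO common unfolding exists — the
leading coordinates always
survive a last-coordinate descent and a common SHADOW would need semialgebraic partial primitives,
which is exactly the catalogued
primitive barrier). InterchangeLemma integrability constant: ∫|R| ≤ ‖f₁‖₁ + ‖f₃‖₁ + ‖g‖₁ (sharp up
to the factor 1 on each term).

DEFINITION REQUESTS. D1 (filed after open, `--kind definition --notion CommonUnfolding --topic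
Literature/NumberTheory/Transcendental`): a file
KZUnfolding.lean with `KZ.permRel`, `KZ.levelRel := AddSubgroup.closure (domainAddRel ∪
integrandAddRel ∪ permRel)`,
`KZ.Round : FormalRep → FormalRep → Prop`, `KZ.CommonUnfolding (r : IntegralRep n) (r' : IntegralRep
m) : Prop` and
`KZ.HasUnfoldingOfHeight (h : ℕ)`, definitionally equal to the `let`-inlined terms of this route,
plus the soundness lemmas
`permRel_subset_changeOfVariablesRel`, `levelRel_le_relations`, `Round.sub_mem_relations`. No cite
facts wanted (Ayoub Rem 1.5 and
Cresson–Viu-Sos §2.1 are remarks, quoted verbatim in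
Literature/Barriers/KontsevichZagierPeriods/AlgebraicPrimitivesObstruction.lean).

Novelty: Searches (2026-08-15, 11:10–12:10Z): `lit search --hybrid "Kontsevich Zagier period conjecture
Fubini interchange order of integration
normal form"` (10 held docs; nearest paper:arxiv-1407.2388 Müller-Stach 'What is a period?' — grep
Fubini/Stokes/rules: only the
standard list of rules, p. 2); `lit vsearch "two integral representations … one integral in more
variables … two different orders"`
(8 irrelevant calculus/number-theory books); `lit search --source zbmath "Kontsevich Zagier period
conjecture"` (9: KZ2001, André 2009,
Ayoub2015, Huber–Wüstholz 2022, CressonViusos2022, ViuSos2021, Terasoma 2010, arXiv:2507.15020,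
arXiv:2008.06749 — none on derivation
normal forms); `lit frontier KontsevichZagierPeriods --since 2020` (30 descendants:
MZV/odd-zeta/motivic coaction papers, nothing on
the presentation of the rules); `lit bridges KontsevichZagierPeriods --cross any` (30, none
relevant); `lit galaxy search … --star pdf
--mode bm25` on 'identities between periods proved by one multiple integral in two orders / normal
form' (12 rows: only
arXiv:1407.2388 relevant); openalex/arxiv remote tiers rate-limited this hour (HTTP 429, recorded in
NOTES.md); the 123 cards of the
sub via `ledger idea list` (couplings appear as certificate SOURCES in
matrix-model-couplings-anderson-selberg and
mellin-coupling-pushforward; ftc-twice-cube-stokes-form has the subgroup-level Tietze reduction of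
rule 2), graded variant; none has the
interchange formula, the diamond, or 'equivalence = common un  [refs: 10.4007/annals.2015.181.3.2, 10.1515/form.1991.3.415, 10.2307/1968867, 2507.15020, 2008.06749, 1407.2388, 1912.01751, paper:arxiv-1407.2388, doi:10.4007/annals.2015.181.3.2, doi:10.1515/form.1991.3.415, doi:10.2307/1968867, Ayoub2015, CressonViusos2022, ViuSos2021, Anderson1991, Newman1942]

Barriers (technique_class: rewriting-normal-form common-unfolding fubini-descent): - technique_class: rewriting-normal-form common-unfolding fubini-descent
- Literature.Barriers.KontsevichZagierPeriods.noSemialgebraicPrimitive_inv_sub_two: EVADED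
structurally and USED — no variable is ever integrated out by COMPUTING a primitive: D-steps are
Newton–Leibniz instances read forwards (the semialgebraic primitive is given data), the interchange
integrand's two primitives are assembled from the given F₁, F₃ and factors affine in the fibre
variable, and the number of variables is NOT fixed (height unbounded, exactly Ayoub's Rem 1.2 escape
'add variables'). The barrier reappears, correctly, as the theorem that VALLEY normal forms (common
shadows) do not exist — e.g. [σ,f] and [σᵀ,fᵀ] have no permutation-free common unfolding — while
PEAK normal forms do; and as the only known tool towards HeightTwoPair.
- Literature.Barriers.KontsevichZagierPeriods.kzConjecture_implies_oddZetaAlgIndep: NOT evaded — X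
is equivalent to the summit given PeakNormalForm, so X inherits ζ(odd)-independence strength; the
bet is on SHAPE (one unknown R, linear shadow constraints, graded by height) feeding sector
constructions and lower bounds, while cruxes 2–4 are transcendence-free.
- Literature.Barriers.KontsevichZagierPeriods.kzConjecture_implies_twoPiI_log_algIndep: same status
as the previous line (strength barrier on X only; cruxes 2–5 do not imply it).
- Literature.Barriers.KontsevichZagierPeriods.kzConjecture_implies_ellipticPeriods_algIndep: same
status (strength barrier on X only)

History (route lifecycle, newest last):
- 2026-08-24T14:43:36Z · DORMANT — reconciler: no traction for 6.8 d (last activity item-evidence-added at 2026-08-17T18:09:59Z); parked, not closed — `ledger route dormant route-KontsevichZagier (operator:999:1913753)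

sub-problem: KontsevichZagierPeriods · status: dormant · opened planner-plancard-KontsevichZagierPeriods-Kont-95794afc-0 2026-08-15T11:35:12Z · rev 3 · ledger route-KontsevichZagierPeriods-CommonUnfolding
GENERATED by the gate from the ledger (D-0016/17). Provers cite these decls: `theorem foo : Summit.KontsevichZagierPeriods.KontsevichZagierPeriods.Theses.CommonUnfolding.<Decl> := …` in Summits/KontsevichZagierPeriods/KontsevichZagierPeriods/Theorems/<Name>.lean.
-/

namespace Summit.KontsevichZagierPeriods.KontsevichZagierPeriods.Theses.CommonUnfolding

open scoped BigOperators Topology Manifold Classical MeasureTheory ProbabilityTheory Matrix InnerProductSpace ComplexConjugate ContinuousMap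
open Filter Set Function TopologicalSpace MeasureTheory

attribute [summit_statement] _root_.KontsevichZagierPeriods

open Literature Periods

/-- item stmt-KontsevichZagierPeriods-4827 · target · rank 0 · open · by planner
why it might fail: At least summit-strength: every strength barrier applies; and if TransportElimination fails for some semialgebraic substitution the permutation-only level class makes X strictly STRONGER than Conjecture 1 (pivot: admit changeOfVariablesRel into Lv).
sources: KontsevichZagier2001, Ayoub2015, CressonViusos2022, Anderson1991
[target] X of § Thesis: KZ-rational r, r′ with equal values have a common unfolding — a peak R :
IntegralRep N and two round-chains (Relation.ReflTransGen of `Rnd`) from [R] ending Lv-equivalent to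
[r] and to [r′]; Lv = AddSubgroup.closure(domainAddRel ∪ integrandAddRel ∪ coordinate-permutation
instances), Rnd C c ⟺ C ≡ ΣBᵢ mod Lv, c = Σbᵢ, each of Bᵢ − of bᵢ ∈ newtonLeibnizRel.
Summit-strength (X ⟺ summit ∧ PeakNormalForm). [difficulty: open-problem] -/
@[route_item "route-KontsevichZagierPeriods-CommonUnfolding"]
def CommonUnfoldingThesis : Prop :=
  let Lv : AddSubgroup Literature.NumberTheory.Transcendental.KZ.FormalRep := AddSubgroup.closure (Literature.NumberTheory.Transcendental.KZ.domainAddRel ∪ Literature.NumberTheory.Transcendental.KZ.integrandAddRel ∪ {c : Literature.NumberTheory.Transcendental.KZ.FormalRep | ∃ (d : ℕ) (s s' : Literature.NumberTheory.Transcendental.KZ.IntegralRep d) (p : Equiv.Perm (Fin d)), s'.domain = (fun x : Fin d → ℝ => x ∘ ⇑p) '' s.domain ∧ (∀ x ∈ s.domain, s.integrand x = s'.integrand (x ∘ ⇑p)) ∧ c = Literature.NumberTheory.Transcendental.KZ.of s - Literature.NumberTheory.Transcendental.KZ.of s'}); let Rnd : Literature.NumberTheory.Transcendental.KZ.FormalRep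 → Literature.NumberTheory.Transcendental.KZ.FormalRep → Prop := fun C c => ∃ (d k : ℕ) (B : Fin k → Literature.NumberTheory.Transcendental.KZ.IntegralRep (d + 1)) (b : Fin k → Literature.NumberTheory.Transcendental.KZ.IntegralRep d), (∀ i, Literature.NumberTheory.Transcendental.KZ.of (B i) - Literature.NumberTheory.Transcendental.KZ.of (b i) ∈ Literature.NumberTheory.Transcendental.KZ.newtonLeibnizRel) ∧ C - ∑ i, Literature.NumberTheory.Transcendental.KZ.of (B i) ∈ Lv ∧ c = ∑ i, Literature.NumberTheory.Transcendental.KZ.of (b i); ∀ ⦃n m : ℕ⦄ (r : Literature.NumberTheory.Transcendental.KZ.IntegralRep n) (r' : Literature.NumberTheory.Transcendental.KZ.IntegralRep m), r.IsRational → r'.IsRational → r.value = r'.value → ∃ (N : ℕ) (R : Literature.NumberTheory.Transcendental.KZ.IntegralRep N) (c c' : Literature.NumberTheory.Transcendental.KZ.FormalRep), Relation.ReflTransGen Rnd (Literature.NumberTheory.Transcendental.KZ.of R) c ∧ Relation.ReflTransGen Rnd (Literature.NumberTheory.Transcendental.KZ.of R) c' ∧ c - Literature.NumberTheory.Transcendental.KZ.of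 r ∈ Lv ∧ c' - Literature.NumberTheory.Transcendental.KZ.of r' ∈ Lv

/-- item stmt-KontsevichZagierPeriods-4828 · crux · rank 2 · open · by planner
why it might fail: Needs TransportElimination; the diamond must survive Lv-equivalences that are permutation coboundaries (G − G′ = Σ(h − h∘p), not plain a.e. equality) and NL's whole-open-fibre differentiability (kinked primitives force extra splits); else only a weaker 'unfold–transport–fold' form holds.
sources: Newman1942, Ayoub2015, CressonViusos2022, KontsevichZagier2001
[crux] SINGLE-PEAK NORMAL FORM (card (T1)+(T2)), transcendence-free: if r (dim n) and r′ (dim m) are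
KZ-equivalent in the fixed calculus then they have a common unfolding in the sense of X (same Lv,
same Rnd; N unbounded). Proof plan: CU is reflexive, symmetric, additive; generators unfold (1a, 1b,
permutations: height 0; Newton–Leibniz: the band itself; rule 2): TransportElimination);
transitivity = DIAMOND: the elementary valley 'one round down from C and from C′ to Lv-equivalent
sums' completes to a common peak ONE round up (refine both band families over a common base
partition by 1a-splits of bands, lift 1b-splits by B ↦ [f − h·g″] + [h·g″] and permutations by
permuting base coordinates of the band, keep merges/deletions as density bookkeeping, then apply the
k×l interchange formula Rᵢⱼ = fᵢ h′ⱼ/l + hᵢ f′ⱼ/k − G hᵢ h′ⱼ/(kl) over each base piece, degenerate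
fibres split off as junk); grid induction; finally [r] − [r′] ∈ relations ⇒ [r]+E ≡ [r′]+E with CU,
and E is cancelled by adding E⁻ (∈ Lv together). [deps: TransportElimination, InterchangeLemma]
[difficulty: XL] -/
@[route_item "route-KontsevichZagierPeriods-CommonUnfolding", crux]
def PeakNormalForm : Prop :=
  let Lv : AddSubgroup Literature.NumberTheory.Transcendental.KZ.FormalRep := AddSubgroup.closure (Literature.NumberTheory.Transcendental.KZ.domainAddRel ∪ Literature.NumberTheory.Transcendental.KZ.integrandAddRel ∪ {c : Literature.NumberTheory.Transcendental.KZ.FormalRep | ∃ (d : ℕ) (s s' : Literature.NumberTheory.Transcendental.KZ.IntegralRep d) (p : Equiv.Perm (Fin d)), s'.domain = (fun x : Fin d → ℝ => x ∘ ⇑p) '' s.domain ∧ (∀ x ∈ s.domain, s.integrand x = s'.integrand (x ∘ ⇑p)) ∧ c = Literature.NumberTheory.Transcendental.KZ.of s - Literature.NumberTheory.Transcendental.KZ.of s'}); let Rnd : Literature.NumberTheory.Transcendental.KZ.FormalRep → Literature.NumberTheory.Transcendental.KZ.FormalRep → Prop := fun C c => ∃ (d k : ℕ) (B : Fin k → Literature.NumberTheory.Transcendental.KZ.IntegralRep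 (d + 1)) (b : Fin k → Literature.NumberTheory.Transcendental.KZ.IntegralRep d), (∀ i, Literature.NumberTheory.Transcendental.KZ.of (B i) - Literature.NumberTheory.Transcendental.KZ.of (b i) ∈ Literature.NumberTheory.Transcendental.KZ.newtonLeibnizRel) ∧ C - ∑ i, Literature.NumberTheory.Transcendental.KZ.of (B i) ∈ Lv ∧ c = ∑ i, Literature.NumberTheory.Transcendental.KZ.of (b i); ∀ ⦃n m : ℕ⦄ (r : Literature.NumberTheory.Transcendental.KZ.IntegralRep n) (r' : Literature.NumberTheory.Transcendental.KZ.IntegralRep m), Literature.NumberTheory.Transcendental.KZ.Equivalent r r' → ∃ (N : ℕ) (R : Literature.NumberTheory.Transcendental.KZ.IntegralRep N) (c c' : Literature.NumberTheory.Transcendental.KZ.FormalRep), Relation.ReflTransGen Rnd (Literature.NumberTheory.Transcendental.KZ.of R) c ∧ Relation.ReflTransGen Rnd (Literature.NumberTheory.Transcendental.KZ.of R) c' ∧ c - Literature.NumberTheory.Transcendental.KZ.of r ∈ Lv ∧ c' - Literature.NumberTheory.Transcendental.KZ.of r' ∈ Lv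

/-- item stmt-KontsevichZagierPeriods-4829 · crux · rank 3 · open · by planner
why it might fail: NL fibres must be bounded and every bookkeeping term of finite mass: unbounded data and endpoint singularities need case-built peaks; the primitive-map factorisation of a merely differentiable injective SA map must hold on FINITELY many cells with ∂φ ≠ 0.
sources: Ayoub2015, Fresan2024, Rudin1976, BochnakCosteRoy1998, CressonViusos2022
[crux] RULE 2) UNFOLDS (card (N3) + card ftc-twice-cube-stokes-form; Ayoub Rem 1.5 in the
semialgebraic calculus): the two sides r, r′ of any change-of-variables instance (Φ ℚ-semialgebraic,
injective, differentiable within σ, f = f′∘Φ·|det Φ′|) have a common unfolding with level class Lv =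
scissors + coordinate permutations only. Plan: null/lower-dimensional and {det Φ′ = 0} parts are
junk; on open cells Φ is C¹ and factors into primitive maps (one coordinate each) and flips (Rudin
10.7, finitely many semialgebraic cells); a one-coordinate substitution u = φ(x,t) unfolds at height
1 by R = ∂ᵤf′(x,u)·∂ₜφ(x,t) on the region between u₀ and φ(x,t) (both partial primitives f′·∂ₜφ and
∂ᵤf′·φ are semialgebraic; anchor u₀ at a regular point so that |R| is integrable), with 1b
bookkeeping of the anchor terms one dimension down; unbounded corners (φ → ∞) need the finite-mass
variant R = ∂ᵥ∂ₜ[h(vt)·t·f(t)] (h polynomial, h′(1)=1, h′(λ)=0, h(1)=h(λ)) on {λ < vt < 1}. Checked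
by hand at height 1 on the reflection pair [(1,2),1/(3−x)] ~ [(1,2),1/x] (peak u⁻²·[u>3−t] +
u⁻²([u<2]−[u>2]) on (1,2)×(1,3)) and on translations (product peak). [deps: InterchangeLemma]
[difficulty: L] -/
@[route_item "route-KontsevichZagierPeriods-CommonUnfolding"]
def TransportElimination : Prop :=
  let Lv : AddSubgroup Literature.NumberTheory.Transcendental.KZ.FormalRep := AddSubgroup.closure (Literature.NumberTheory.Transcendental.KZ.domainAddRel ∪ Literature.NumberTheory.Transcendental.KZ.integrandAddRel ∪ {c : Literature.NumberTheory.Transcendental.KZ.FormalRep | ∃ (d : ℕ) (s s' : Literature.NumberTheory.Transcendental.KZ.IntegralRep d) (p : Equiv.Perm (Fin d)), s'.domain = (fun x : Fin d → ℝ => x ∘ ⇑p) '' s.domain ∧ (∀ x ∈ s.domain, s.integrand x = s'.integrand (x ∘ ⇑p)) ∧ c = Literature.NumberTheory.Transcendental.KZ.of s - Literature.NumberTheory.Transcendental.KZ.of s'}); let Rnd : Literature.NumberTheory.Transcendental.KZ.FormalRep → Literature.NumberTheory.Transcendental.KZ.FormalRep → Prop := fun C c => ∃ (d k : ℕ) (B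 : Fin k → Literature.NumberTheory.Transcendental.KZ.IntegralRep (d + 1)) (b : Fin k → Literature.NumberTheory.Transcendental.KZ.IntegralRep d), (∀ i, Literature.NumberTheory.Transcendental.KZ.of (B i) - Literature.NumberTheory.Transcendental.KZ.of (b i) ∈ Literature.NumberTheory.Transcendental.KZ.newtonLeibnizRel) ∧ C - ∑ i, Literature.NumberTheory.Transcendental.KZ.of (B i) ∈ Lv ∧ c = ∑ i, Literature.NumberTheory.Transcendental.KZ.of (b i); ∀ ⦃n : ℕ⦄ (r r' : Literature.NumberTheory.Transcendental.KZ.IntegralRep n), Literature.NumberTheory.Transcendental.KZ.of r - Literature.NumberTheory.Transcendental.KZ.of r' ∈ Literature.NumberTheory.Transcendental.KZ.changeOfVariablesRel → ∃ (N : ℕ) (R : Literature.NumberTheory.Transcendental.KZ.IntegralRep N) (c c' : Literature.NumberTheory.Transcendental.KZ.FormalRep), Relation.ReflTransGen Rnd (Literature.NumberTheory.Transcendental.KZ.of R) c ∧ Relation.ReflTransGen Rnd (Literature.NumberTheory.Transcendental.KZ.of R) c' ∧ c - Literature.NumberTheory.Transcendental.KZ.of r ∈ Lv ∧ c' - Literature.NumberTheory.Transcendental.KZ.of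 r' ∈ Lv

/-- item stmt-KontsevichZagierPeriods-4830 · crux · rank 4 · closed · proved by Summit.KontsevichZagierPeriods.CommonUnfolding.interchangeLemma_proof @ 0b27865622d7 (prover) · by planner
why it might fail: Only through the exact side conditions of newtonLeibnizRel: extracting (a,b,F) from a membership in the free abelian group, semialgebraicity of 1/(b−a) and of F₃∘(x,s) on the double band, Tonelli for integrability; degenerate fibres are excluded by hypothesis on purpose.
sources: KontsevichZagier2001, Anderson1991, Newman1942
[crux] EVERY VALLEY IS A PEAK (card (N1)), provable now: if b₁ and b₃ (dim n+1) both descend to the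
same base r₂ (dim n) by one Newton–Leibniz instance each, and all fibres of both bands over
r₂.domain are nondegenerate, then there is a double band R (dim n+2) over b₁ — fibre coordinate s ∈
[a₃ x, b₃ x], integrand R(x,t,s) = f₁(x,t)h₃(x) + h₁(x)f₃(x,s) − g(x)h₁(x)h₃(x), hᵢ = 1/(bᵢ−aᵢ),
s-primitive f₁·(s−a₃)h₃ + h₁F₃ − g h₁(s−a₃)h₃ — with `of R − of b₁ ∈ newtonLeibnizRel`, and its
coordinate swap R′(x,s,t) = R(x,t,s) satisfies `of R′ − of b₃ ∈ newtonLeibnizRel` (t-primitive F₁h₃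
+ h₁(t−a₁)f₃ − g(t−a₁)h₁h₃); R′ is the image of R under the swap of the last two coordinates (a
permutation level move). ∫|R| ≤ ‖f₁‖₁ + ‖f₃‖₁ + ‖g‖₁. Est. 400–700 lines over
KZCalculus/SemialgebraicMapsProofs (Tarski–Seidenberg in tree). [difficulty: provable-now] -/
@[route_item "route-KontsevichZagierPeriods-CommonUnfolding"]
def InterchangeLemma : Prop :=
  ∀ ⦃n : ℕ⦄ (r₂ : Literature.NumberTheory.Transcendental.KZ.IntegralRep n) (b₁ b₃ : Literature.NumberTheory.Transcendental.KZ.IntegralRep (n + 1)), Literature.NumberTheory.Transcendental.KZ.of b₁ - Literature.NumberTheory.Transcendental.KZ.of r₂ ∈ Literature.NumberTheory.Transcendental.KZ.newtonLeibnizRel → Literature.NumberTheory.Transcendental.KZ.of b₃ - Literature.NumberTheory.Transcendental.KZ.of r₂ ∈ Literature.NumberTheory.Transcendental.KZ.newtonLeibnizRel → (∀ x ∈ r₂.domain, ∃ t t' : ℝ, t < t' ∧ (Fin.snoc x t : Fin (n + 1) → ℝ) ∈ b₁.domain ∧ (Fin.snoc x t' : Fin (n + 1) → ℝ) ∈ b₁.domain)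 → (∀ x ∈ r₂.domain, ∃ t t' : ℝ, t < t' ∧ (Fin.snoc x t : Fin (n + 1) → ℝ) ∈ b₃.domain ∧ (Fin.snoc x t' : Fin (n + 1) → ℝ) ∈ b₃.domain) → ∃ (R R' : Literature.NumberTheory.Transcendental.KZ.IntegralRep (n + 2)), Literature.NumberTheory.Transcendental.KZ.of R - Literature.NumberTheory.Transcendental.KZ.of b₁ ∈ Literature.NumberTheory.Transcendental.KZ.newtonLeibnizRel ∧ Literature.NumberTheory.Transcendental.KZ.of R' - Literature.NumberTheory.Transcendental.KZ.of b₃ ∈ Literature.NumberTheory.Transcendental.KZ.newtonLeibnizRel ∧ R'.domain = (fun w : Fin (n + 2) → ℝ => w ∘ ⇑(Equiv.swap (Fin.castSucc (Fin.last n)) (Fin.last (n + 1)))) '' R.domain ∧ ∀ w ∈ R.domain, R.integrand w = R'.integrand (w ∘ ⇑(Equiv.swap (Fin.castSucc (Fin.last n)) (Fin.last (n + 1))))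

/-- item stmt-KontsevichZagierPeriods-4831 · crux · rank 5 · open · by planner
why it might fail: Height might always compress to 1 in dimension 2 (no lower-bound technique for unfolding height exists; the only tool is the one-sided obstruction noSemialgebraicPrimitive_inv_sub_two), and the positive half needs an explicit height-2 unfolding of a genuinely transcendental pair.
sources: Ayoub2015, Fresan2024, KontsevichZagier2001, Literature/Barriers/KontsevichZagierPeriods/AlgebraicPrimitivesObstruction.lean
[crux] FIRST HEIGHT LOWER BOUND (card (N4); Ayoub's Rem 1.2 heuristic 'the number of variables must
grow' made a theorem at the first level): there are KZ-rational r, r′ of dimension 2 that HAVE a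
common unfolding but none with peak dimension N ≤ 3 (height ≤ 1). Candidates: KZ's ζ(2) pair
([(0,1)², 1/(1−xy)] against a rational π²/6-representation; KZ's own chain has height 2),
Gauss-multiplication pairs. A proof is a two-sided version of the catalogued primitive obstruction:
no semialgebraic R on a 3-dimensional set has the two prescribed iterated shadows with semialgebraic
partial primitives. [deps: PeakNormalForm] [difficulty: open-problem] -/
@[route_item "route-KontsevichZagierPeriods-CommonUnfolding"]
def HeightTwoPair : Prop :=
  let Lv : AddSubgroup Literature.NumberTheory.Transcendental.KZ.FormalRep := AddSubgroup.closure (Literature.NumberTheory.Transcendental.KZ.domainAddRel ∪ Literature.NumberTheory.Transcendental.KZ.integrandAddRel ∪ {c : Literature.NumberTheory.Transcendental.KZ.FormalRep | ∃ (d : ℕ) (s s' : Literature.NumberTheory.Transcendental.KZ.IntegralRep d) (p : Equiv.Perm (Fin d)), s'.domain = (fun x : Fin d → ℝ => x ∘ ⇑p) '' s.domain ∧ (∀ x ∈ s.domain, s.integrand x = s'.integrand (x ∘ ⇑p)) ∧ c = Literature.NumberTheory.Transcendental.KZ.of s - Literature.NumberTheory.Transcendental.KZ.of s'}); let Rnd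 : Literature.NumberTheory.Transcendental.KZ.FormalRep → Literature.NumberTheory.Transcendental.KZ.FormalRep → Prop := fun C c => ∃ (d k : ℕ) (B : Fin k → Literature.NumberTheory.Transcendental.KZ.IntegralRep (d + 1)) (b : Fin k → Literature.NumberTheory.Transcendental.KZ.IntegralRep d), (∀ i, Literature.NumberTheory.Transcendental.KZ.of (B i) - Literature.NumberTheory.Transcendental.KZ.of (b i) ∈ Literature.NumberTheory.Transcendental.KZ.newtonLeibnizRel) ∧ C - ∑ i, Literature.NumberTheory.Transcendental.KZ.of (B i) ∈ Lv ∧ c = ∑ i, Literature.NumberTheory.Transcendental.KZ.of (b i); ∃ (r r' : Literature.NumberTheory.Transcendental.KZ.IntegralRep 2), r.IsRational ∧ r'.IsRational ∧ (∃ (N : ℕ) (R : Literature.NumberTheory.Transcendental.KZ.IntegralRep N) (c c' : Literature.NumberTheory.Transcendental.KZ.FormalRep), Relation.ReflTransGen Rnd (Literature.NumberTheory.Transcendental.KZ.of R) c ∧ Relation.ReflTransGen Rnd (Literature.NumberTheory.Transcendental.KZ.of R) c' ∧ c - Literature.NumberTheory.Transcendental.KZ.of r ∈ Lv ∧ c'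 - Literature.NumberTheory.Transcendental.KZ.of r' ∈ Lv) ∧ ¬ (∃ (N : ℕ) (R : Literature.NumberTheory.Transcendental.KZ.IntegralRep N) (c c' : Literature.NumberTheory.Transcendental.KZ.FormalRep), N ≤ 3 ∧ Relation.ReflTransGen Rnd (Literature.NumberTheory.Transcendental.KZ.of R) c ∧ Relation.ReflTransGen Rnd (Literature.NumberTheory.Transcendental.KZ.of R) c' ∧ c - Literature.NumberTheory.Transcendental.KZ.of r ∈ Lv ∧ c' - Literature.NumberTheory.Transcendental.KZ.of r' ∈ Lv)

/-- item stmt-KontsevichZagierPeriods-14445 · crux · rank 9 · open · by planner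
why it might fail: Summit-strength: given PeakNormalForm it is EQUIVALENT to Conjecture 1, so it fails exactly when the period conjecture fails (one pair of equal periods joined by no chain of moves); all three strength barriers apply. Unstaffed complement (rank 9).
sources: KontsevichZagier2001, Ayoub2015, Fresan2024, HuberMullerStach2017, CressonViusos2022, ViuSos2021
[support] COMPLEMENT of the normal form (conjecture-grade, summit-strength; filed by the
route-choice repair 2026-08-16 to close the deciding theorem's type honestly — hold
`target-unreachable`: no crux reached the target): GIVEN the single-peak normal form PeakNormalForm
(crux rank 2: KZ-equivalent ⇒ common unfolding), every two KZ-rational integral representations with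
the same value have a common unfolding, i.e. PeakNormalForm → CommonUnfoldingThesis. LOGIC
(planner's Sketch.lean, rc 0): CommonUnfoldingThesis ↔ KontsevichZagierPeriods ∧ (PeakNormalForm on
rational pairs), so this item is EQUIVALENT TO CONJECTURE 1 given PeakNormalForm
(`unfoldingComplement_iff`); the route's own cruxes (PeakNormalForm, TransportElimination,
InterchangeLemma) are transcendence-free and prove only the converse direction (faithfulness of X),
so no provable glue to the target exists and the missing input is exactly the existence of peaks for
equal values. It is NOT staffed by this route's mechanism (keep rank 9, like
FurushoPentagon.SectorToKernel / Grothendieck.SectorComplement); the deciding theorem is re-cut to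
`closes (hP : PeakNormalForm) (hC : UnfoldingComplement)`, the target being their comp -/
@[route_item "route-KontsevichZagierPeriods-CommonUnfolding", crux]
def UnfoldingComplement : Prop :=
  Summit.KontsevichZagierPeriods.KontsevichZagierPeriods.Theses.CommonUnfolding.PeakNormalForm → Summit.KontsevichZagierPeriods.KontsevichZagierPeriods.Theses.CommonUnfolding.CommonUnfoldingThesis

/-- item stmt-KontsevichZagierPeriods-4832 · assembly · rank 1 · closed · proved by Summit.KontsevichZagierPeriods.CommonUnfolding.assembly_proof @ 52ab49a00509 (prover) · by planner
sources: KontsevichZagier2001, ViuSos2021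
[assembly] CommonUnfoldingThesis → KontsevichZagierPeriods (soundness of descents: level moves and
forward Newton–Leibniz rounds are relations). -/
@[route_item "route-KontsevichZagierPeriods-CommonUnfolding"]
def Assembly : Prop :=
  CommonUnfoldingThesis → KontsevichZagierPeriods

/-! D-0027 §2.1 — DECIDING THEOREM (planner-authored via `route open/edit --closes-file`; by planner-rchoice-KontsevichZagierPeriods-Common-0b13557e-0 2026-08-16T03:44:41Z):
its hypotheses are this route's items and its conclusion the sub-problem Statement (glue_lint), and it elaborates with this file. -/

/-- Deciding theorem (D-0027 §2.1), re-cut by the route-choice repair 2026-08-16 (hold `target-unreachable`).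
Hypotheses: the rank-2 crux `PeakNormalForm` (single-peak normal form: KZ-equivalence ⇒ common unfolding;
transcendence-free) and the conjecture-grade COMPLEMENT `UnfoldingComplement : PeakNormalForm → CommonUnfoldingThesis`
(≡ Conjecture 1 given the normal form; filed at rank 9 to close the type honestly, not staffed by this route's mechanism).
The target `CommonUnfoldingThesis` is their composite `hC hP` and is consumed below exactly as in rev 1: a common
unfolding is a relation because level moves (rules 1a, 1b, coordinate permutations as |det| = 1 changes of variables)
and forward Newton–Leibniz rounds are relations, and the two descents telescope. No import beyond the route file's. -/
@[closes "route-KontsevichZagierPeriods-CommonUnfolding"] theorem closes (hP : PeakNormalForm) (hC : UnfoldingComplement) : KontsevichZagierPeriods := by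
  have hX : CommonUnfoldingThesis := hC hP
  intro n m r r' hr hr' hv
  obtain ⟨N, R, c, c', hc, hc', hcr, hcr'⟩ := hX r r' hr hr' hv
  -- (1) LEVEL MOVES ARE RELATIONS: domain/integrand additivity are moves (1a)/(1b); a coordinate
  -- permutation `x ↦ x ∘ p` is a change-of-variables move (2): a `ℚ`-polynomial map, injective,
  -- its own derivative (the permutation matrix), `|det| = 1`.
  have hLv : AddSubgroup.closure (Literature.NumberTheory.Transcendental.KZ.domainAddRel ∪
      Literature.NumberTheory.Transcendental.KZ.integrandAddRel ∪
      {c : Literature.NumberTheory.Transcendental.KZ.FormalRep | ∃ (d : ℕ)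
        (s s' : Literature.NumberTheory.Transcendental.KZ.IntegralRep d) (p : Equiv.Perm (Fin d)),
        s'.domain = (fun x : Fin d → ℝ => x ∘ ⇑p) '' s.domain ∧
        (∀ x ∈ s.domain, s.integrand x = s'.integrand (x ∘ ⇑p)) ∧
        c = Literature.NumberTheory.Transcendental.KZ.of s -
          Literature.NumberTheory.Transcendental.KZ.of s'}) ≤
      Literature.NumberTheory.Transcendental.KZ.relations := by
    refine (AddSubgroup.closure_le _).mpr ?_
    rintro x ((hx | hx) | ⟨d, s, s', p, hdom, hint, rfl⟩)
    · exact Literature.NumberTheory.Transcendental.KZ.domainAddRel_subset_relations hx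
    · exact Literature.NumberTheory.Transcendental.KZ.integrandAddRel_subset_relations hx
    · refine Literature.NumberTheory.Transcendental.KZ.changeOfVariablesRel_subset_relations ?_
      let M : Matrix (Fin d) (Fin d) ℝ := (1 : Matrix (Fin d) (Fin d) ℝ).submatrix p (Equiv.refl _)
      let L : (Fin d → ℝ) →L[ℝ] (Fin d → ℝ) := LinearMap.toContinuousLinearMap (Matrix.toLin' M)
      have hL : ∀ z : Fin d → ℝ, L z = fun j => z (p j) := by
        intro z
        change Matrix.toLin' M z = _
        rw [Matrix.toLin'_apply, Matrix.submatrix_mulVec_equiv, Matrix.one_mulVec]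
        rfl
      have hdet : |L.det| = 1 := by
        change |LinearMap.det (Matrix.toLin' M)| = 1
        rw [LinearMap.det_toLin', Matrix.abs_det_submatrix_equiv_equiv, Matrix.det_one, abs_one]
      refine ⟨d, s, s', fun x => x ∘ ⇑p, fun _ => L, ?_, ?_, ?_, hdom, ?_, rfl⟩
      · convert Literature.NumberTheory.Transcendental.isSemialgebraicMapOn_aeval
          s.isSemialgebraic_domain (fun j => (MvPolynomial.X (p j) : MvPolynomial (Fin d) ℚ))
          using 2 with z
        ext j; simp
      · intro z _
        have h := L.hasFDerivWithinAt (s := s.domain) (x := z)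
        convert h using 1
        ext z' j
        rw [hL]
        rfl
      · intro z₁ _ z₂ _ h
        ext i
        have := congrFun h (p.symm i)
        simpa using this
      · intro z hz
        rw [hdet, mul_one]
        exact hint z hz
  -- (2) A CHAIN OF ROUNDS IS A RELATION: one round `C ⟶ ∑ [bᵢ]` is
  -- `C − ∑ [bᵢ] = (C − ∑ [Bᵢ]) + ∑ ([Bᵢ] − [bᵢ])`, a level move plus Newton–Leibniz moves (3);
  -- then induct along `Relation.ReflTransGen`, telescoping.
  have hchain : ∀ {C c₀ : Literature.NumberTheory.Transcendental.KZ.FormalRep},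
      Relation.ReflTransGen (fun C c => ∃ (d k : ℕ)
        (B : Fin k → Literature.NumberTheory.Transcendental.KZ.IntegralRep (d + 1))
        (b : Fin k → Literature.NumberTheory.Transcendental.KZ.IntegralRep d),
        (∀ i, Literature.NumberTheory.Transcendental.KZ.of (B i) -
          Literature.NumberTheory.Transcendental.KZ.of (b i) ∈
            Literature.NumberTheory.Transcendental.KZ.newtonLeibnizRel) ∧
        C - ∑ i, Literature.NumberTheory.Transcendental.KZ.of (B i) ∈
          AddSubgroup.closure (Literature.NumberTheory.Transcendental.KZ.domainAddRel ∪
            Literature.NumberTheory.Transcendental.KZ.integrandAddRel ∪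
            {c : Literature.NumberTheory.Transcendental.KZ.FormalRep | ∃ (d : ℕ)
              (s s' : Literature.NumberTheory.Transcendental.KZ.IntegralRep d) (p : Equiv.Perm (Fin d)),
              s'.domain = (fun x : Fin d → ℝ => x ∘ ⇑p) '' s.domain ∧
              (∀ x ∈ s.domain, s.integrand x = s'.integrand (x ∘ ⇑p)) ∧
              c = Literature.NumberTheory.Transcendental.KZ.of s -
                Literature.NumberTheory.Transcendental.KZ.of s'}) ∧
        c = ∑ i, Literature.NumberTheory.Transcendental.KZ.of (b i)) C c₀ →
      C - c₀ ∈ Literature.NumberTheory.Transcendental.KZ.relations := by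
    intro C c₀ h
    induction h with
    | refl =>
      rw [sub_self]
      exact Literature.NumberTheory.Transcendental.KZ.relations.zero_mem
    | @tail b₀ c₁ _ hbc ih =>
      obtain ⟨d, k, B, b, hNL, hB, rfl⟩ := hbc
      have hsum : ∑ i, (Literature.NumberTheory.Transcendental.KZ.of (B i) -
          Literature.NumberTheory.Transcendental.KZ.of (b i)) ∈
            Literature.NumberTheory.Transcendental.KZ.relations :=
        sum_mem fun i _ =>
          Literature.NumberTheory.Transcendental.KZ.newtonLeibnizRel_subset_relations (hNL i)
      have key : C - ∑ i, Literature.NumberTheory.Transcendental.KZ.of (b i) =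
          (C - b₀) + ((b₀ - ∑ i, Literature.NumberTheory.Transcendental.KZ.of (B i)) +
            ∑ i, (Literature.NumberTheory.Transcendental.KZ.of (B i) -
              Literature.NumberTheory.Transcendental.KZ.of (b i))) := by
        rw [Finset.sum_sub_distrib]
        abel
      rw [key]
      exact add_mem ih (add_mem (hLv hB) hsum)
  -- (3) TELESCOPE: `[r] − [r'] = ([R] − c') + (c' − [r']) − ([R] − c) − (c − [r])`.
  have h₁ := hchain hc
  have h₂ := hchain hc'
  have h₃ := hLv hcr
  have h₄ := hLv hcr'
  show Literature.NumberTheory.Transcendental.KZ.of r - Literature.NumberTheory.Transcendental.KZ.of r' ∈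
    Literature.NumberTheory.Transcendental.KZ.relations
  have key : Literature.NumberTheory.Transcendental.KZ.of r -
      Literature.NumberTheory.Transcendental.KZ.of r' =
      (Literature.NumberTheory.Transcendental.KZ.of R - c') +
        (c' - Literature.NumberTheory.Transcendental.KZ.of r') -
        (Literature.NumberTheory.Transcendental.KZ.of R - c) -
        (c - Literature.NumberTheory.Transcendental.KZ.of r) := by
    abel
  rw [key]
  exact sub_mem (sub_mem (add_mem h₂ h₄) h₁) h₃

end Summit.KontsevichZagierPeriods.KontsevichZagierPeriods.Theses.CommonUnfolding
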